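import Mathlib
import Literature.RingTheory.CohomologyAnnihilator.Basic
import Literature.RingTheory.CohomologyAnnihilator.StableAnnihilation
import Summits.ResolutionOfSingularities.ResolutionOfSingularities.Theorems.HomologicalConductorPersistenceExtFlatBaseChange
import Summits.ResolutionOfSingularities.ResolutionOfSingularities.Theorems.HomologicalConductorPersistenceRelativeSequence
import HarnessLib

/-!
# The relative `Ext` sequence `0 → C_{m-1} → Extᵐ_R(M, N) → K_m → 0` (THEOREM A (1.3))

Crux `HomologicalConductor.Persistence` (stmt-ResolutionOfSingularities-16484), chain W4.4b; pool object
**W4.4b U1 = THEOREM A in Lean**, FILE 1c. Source: res-L1-w44b-stub-3, `L/res-L1-w44b-stub-3/THEOREM-A.md`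
c2177413955d684d §1 (1.3) «`0 → C_{m−1} → Ext^m_R(M,N) —ρ_m→ K_m → 0`, `K_m := ker (u₂ − u₁ | E_m)`,
`C_{m−1} := coker (u₂ − u₁ | E_{m−1})`, `E_m = Extᵐ_A(M|_A, N|_A)` … this is the long exact `Ext`
sequence of (1.1) made explicit». `[OURS · L1 w44b]` — folklore homological algebra, NOT a statement
of the manuscript under review in cell res-hironaka and using none of its statements; AI-written,
weaker than expert review.

Setting as in `…PersistenceRelativeSequence`: `R = A[x]` an `A`-algebra with an `A`-basis of powers
of `x` (`b n = x ^ n`), `M` any `R`-module (`[IsScalarTower A R M]`), `N : ModuleCat R`,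
`N|_A := (restrictScalars (algebraMap A R)).obj N`, `T`, `μ` the maps of the relative sequence
(characterised on pure tensors), `S = (T, μ)` the short exact sequence of p519454.

* §1 the three exactness statements of the long exact sequence of `S` in the first variable
  (Mathlib `Ext.contravariant_sequence_exact₁'/₂'/₃'`), unbundled:
  `mk₀T_comp_eq_zero_iff` (**`K_m`**: `T^* e' = 0 ↔ e' = μ^* e` for some `e` — `im ρ_m = ker T^*`),
  `mk₀μ_comp_eq_zero_iff` (`ker ρ_m = im ∂`), `extClass_comp_eq_zero_iff` (`ker ∂ = im T^*`, so
  `im ∂ ≅ coker T^* =` **`C_{m−1}`**).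
* §2 **`T^* = u₂ − u₁`**: `exists_iso_extendScalars_comm` (the identity-on-pure-tensors isomorphism
  `ModuleCat.of R (R ⊗[A] M) ≅ R ⊗_A (M|_A)` intertwines `T` with `x • 𝟙 − R ⊗_A (x•)`), and
  **`exists_extBaseChange_relative`**: an additive BIJECTION
  `Ψ : Extⁿ_A(M|_A, N|_A) → Extⁿ_R(R ⊗_A M, N)` with `Ψ (c • e) = algebraMap c • Ψ e` and
  `T^* (Ψ e) = Ψ (u₂ e − u₁ e)`, where `u₁ e = (x•)^* e` (precomposition with `x • −` on `M|_A`) and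
  `u₂ e = (x•)_* e` (postcomposition with `x • −` on `N|_A`). Hence `K_m = Ψ (ker (u₂ − u₁))` and
  `C_{m−1} ≅ coker (u₂ − u₁ | E_{m−1})` — THEOREM-A (1.3) verbatim (last clause of the package:
  `T^* (Ψ e) = 0 ↔ u₂ e = u₁ e`).
-/

-- single-problem summit: the doubled namespace component is forced
set_option linter.dupNamespace false

noncomputable section

open CategoryTheory CategoryTheory.Abelian CategoryTheory.Limits
open scoped TensorProduct

universe u

namespace Summit.ResolutionOfSingularities.ResolutionOfSingularities.Theorems.HomologicalConductor.PersistenceRelativeExtSequence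

open Literature.RingTheory.CohomologyAnnihilator
open Summit.ResolutionOfSingularities.ResolutionOfSingularities.Theorems.HomologicalConductor.PersistenceExtFlatBaseChange
open Summit.ResolutionOfSingularities.ResolutionOfSingularities.Theorems.HomologicalConductor.PersistenceRelativeSequence

variable {A R : Type u} [CommRing A] [CommRing R] [Algebra A R] (x : R) {M : Type u} [AddCommGroup M]
  [Module A M] [Module R M] (T : R ⊗[A] M →ₗ[R] R ⊗[A] M) (μ : R ⊗[A] M →ₗ[R] M)

/-! ## §1 The long exact sequence of the relative sequence, unbundled -/

section LES

variable {T μ} {w : ModuleCat.ofHom (X := R ⊗[A] M) (Y := R ⊗[A] M) T ≫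
    ModuleCat.ofHom (X := R ⊗[A] M) (Y := M) μ = 0}
  (hS : (ShortComplex.mk (ModuleCat.ofHom (X := R ⊗[A] M) (Y := R ⊗[A] M) T)
    (ModuleCat.ofHom (X := R ⊗[A] M) (Y := M) μ) w).ShortExact)
include hS

/-- **`K_m = im ρ_m = ker T^*`** (exactness at `Extᵐ(R ⊗_A M, N)`): a class `e'` on `R ⊗_A M` is
killed by `T^*` iff it is `μ^* e` for a (unique, `μ^*` being injective modulo `∂`) class `e` on `M`.
[folklore] -/
theorem mk₀T_comp_eq_zero_iff {N : ModuleCat.{u} R} {m : ℕ}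
    (e' : Ext.{u} (ModuleCat.of R (R ⊗[A] M)) N m) :
    (Ext.mk₀ (ModuleCat.ofHom (X := R ⊗[A] M) (Y := R ⊗[A] M) T)).comp e' (zero_add m) = 0 ↔
      ∃ e : Ext.{u} (ModuleCat.of R M) N m,
        (Ext.mk₀ (ModuleCat.ofHom (X := R ⊗[A] M) (Y := M) μ)).comp e (zero_add m) = e' := by
  constructor
  · intro h
    exact Ext.contravariant_sequence_exact₂ hS N e' h
  · rintro ⟨e, rfl⟩
    rw [← Ext.comp_assoc_of_second_deg_zero, Ext.mk₀_comp_mk₀]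
    have : ModuleCat.ofHom (X := R ⊗[A] M) (Y := R ⊗[A] M) T ≫
        ModuleCat.ofHom (X := R ⊗[A] M) (Y := M) μ = 0 := w
    rw [this, Ext.mk₀_zero, Ext.zero_comp]

/-- **`ker ρ_m = im ∂`** (exactness at `Ext^{m+1}(M, N)`): `μ^* e = 0` iff `e = ∂ y` for some class
`y` on `R ⊗_A M` one degree down (`∂ = hS.extClass ∘ −`). [folklore] -/
theorem mk₀μ_comp_eq_zero_iff {N : ModuleCat.{u} R} {m : ℕ}
    (e : Ext.{u} (ModuleCat.of R M) N (m + 1)) :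
    (Ext.mk₀ (ModuleCat.ofHom (X := R ⊗[A] M) (Y := M) μ)).comp e (zero_add (m + 1)) = 0 ↔
      ∃ y : Ext.{u} (ModuleCat.of R (R ⊗[A] M)) N m, hS.extClass.comp y (add_comm 1 m) = e := by
  constructor
  · intro h
    exact Ext.contravariant_sequence_exact₃ hS N e h (add_comm 1 m)
  · rintro ⟨y, rfl⟩
    rw [← Ext.comp_assoc (Ext.mk₀ _) hS.extClass y (zero_add 1) (add_comm 1 m) (by omega),
      hS.comp_extClass, Ext.zero_comp]

/-- **`ker ∂ = im T^*`** (exactness at `Extᵐ(R ⊗_A M, N)` one step earlier): `∂ y = 0` iff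
`y = T^* z`; hence `im ∂ ≅ Extᵐ(R ⊗_A M, N) / im T^* = C_m`. [folklore] -/
theorem extClass_comp_eq_zero_iff {N : ModuleCat.{u} R} {m : ℕ}
    (y : Ext.{u} (ModuleCat.of R (R ⊗[A] M)) N m) :
    hS.extClass.comp y (add_comm 1 m) = 0 ↔
      ∃ z : Ext.{u} (ModuleCat.of R (R ⊗[A] M)) N m,
        (Ext.mk₀ (ModuleCat.ofHom (X := R ⊗[A] M) (Y := R ⊗[A] M) T)).comp z (zero_add m) = y := by
  constructor
  · intro h
    exact Ext.contravariant_sequence_exact₁ hS N y (add_comm 1 m) h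
  · rintro ⟨z, rfl⟩
    rw [← Ext.comp_assoc hS.extClass (Ext.mk₀ _) z (add_zero 1) (zero_add m) (by omega),
      hS.extClass_comp, Ext.zero_comp]

end LES

/-! ## §2 `T^* = u₂ − u₁` under the flat base change -/

section Transport

variable [IsScalarTower A R M]
  (hT : ∀ (p : R) (m : M), T (p ⊗ₜ[A] m) = (x * p) ⊗ₜ[A] m - p ⊗ₜ[A] (x • m))
include hT

set_option backward.isDefEq.respectTransparency false in
/-- The identity-on-pure-tensors isomorphism `ModuleCat.of R (R ⊗[A] M) ≅ R ⊗_A (M|_A)`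
(`= (extendScalars (algebraMap A R)).obj (ModuleCat.of A M)`) intertwines `T` with
`x • 𝟙 − R ⊗_A (x • −)`. [folklore] -/
theorem exists_iso_extendScalars_comm :
    ∃ ι : ModuleCat.of R (R ⊗[A] M) ≅
        (ModuleCat.extendScalars.{u, u, u} (algebraMap A R)).obj (ModuleCat.of A M),
      ModuleCat.ofHom (X := R ⊗[A] M) (Y := R ⊗[A] M) T ≫ ι.hom =
        ι.hom ≫ (x • 𝟙 _ - (ModuleCat.extendScalars.{u, u, u} (algebraMap A R)).map
          (ModuleCat.ofHom ((LinearMap.lsmul R M x).restrictScalars A))) := by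
  let R' := (ModuleCat.restrictScalars.{u, u, u} (algebraMap A R)).obj (ModuleCat.of R R)
  let e : R ≃ₗ[A] R' :=
    { toFun := fun r => r
      map_add' := fun _ _ => rfl
      map_smul' := fun a r => Algebra.smul_def a r
      invFun := fun r => r
      left_inv := fun _ => rfl
      right_inv := fun _ => rfl }
  let ψ : R ⊗[A] M ≃ₗ[A] R' ⊗[A] M := TensorProduct.congr e (LinearEquiv.refl A M)
  have hψ : ∀ (r : R) (m : M), ψ (r ⊗ₜ m) = (e r) ⊗ₜ m := fun r m => rfl
  have hsmul : ∀ (r : R) (z : R ⊗[A] M),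
      ψ (r • z) = (r • ψ z :
        (ModuleCat.extendScalars.{u, u, u} (algebraMap A R)).obj (ModuleCat.of A M)) := by
    intro r z
    induction z using TensorProduct.induction_on with
    | zero => rw [smul_zero, map_zero, smul_zero]
    | tmul s m =>
      rw [TensorProduct.smul_tmul', hψ, smul_eq_mul, hψ]
      rfl
    | add z w hz hw => rw [smul_add, map_add, hz, hw, map_add, smul_add]
  let Ψ : R ⊗[A] M ≃ₗ[R]
      (ModuleCat.extendScalars.{u, u, u} (algebraMap A R)).obj (ModuleCat.of A M) :=
    { ψ with map_smul' := hsmul }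
  have hΨ : ∀ (r : R) (m : M), Ψ (r ⊗ₜ m) =
      ((e r) ⊗ₜ m : (ModuleCat.extendScalars.{u, u, u} (algebraMap A R)).obj (ModuleCat.of A M)) :=
    fun r m => rfl
  refine ⟨Ψ.toModuleIso, ?_⟩
  apply ModuleCat.hom_ext
  refine LinearMap.ext fun z => ?_
  induction z using TensorProduct.induction_on with
  | zero => rw [map_zero, map_zero]
  | tmul s m =>
    change Ψ (T (s ⊗ₜ m)) = x • Ψ (s ⊗ₜ m) -
      (ModuleCat.extendScalars.{u, u, u} (algebraMap A R)).map
        (ModuleCat.ofHom ((LinearMap.lsmul R M x).restrictScalars A)) (Ψ (s ⊗ₜ m))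
    rw [hT, map_sub, hΨ, hΨ, hΨ]
    erw [ModuleCat.ExtendScalars.map_tmul]
    rfl
  | add z w hz hw => rw [map_add, map_add, hz, hw]


/-- **THEOREM-A (1.3): `T^* = u₂ − u₁` under the flat base change.** For `R = A[x]` (free on the
powers of `x`), any `R`-module `M`, any `R`-module `N` and any degree `n` there is an additive
BIJECTION `Ψ : Extⁿ_A(M|_A, N|_A) → Extⁿ_R(R ⊗_A M, N)` (`M|_A = ModuleCat.of A M`,
`N|_A = restrictScalars (algebraMap A R) N`; `Ψ` = the flat base change `Φ` of
`…PersistenceExtFlatBaseChange.exists_extBaseChange` followed by the identity-on-pure-tensors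
isomorphism of `exists_iso_extendScalars_comm`) such that `Ψ (c • e) = algebraMap c • Ψ e` and
**`T^* (Ψ e) = Ψ (u₂ e − u₁ e)`**, where `u₂ e = e ∘ (x • 𝟙_N)|_A` (the action of `u` through `N`)
and `u₁ e = (x • −)|_{M} ∘ e` (the action of `u` through `M`): so `K_m = ker T^* = Ψ (ker (u₂ − u₁))`
and `im T^* = Ψ (im (u₂ − u₁))`, i.e. `E_m`, `K_m`, `C_{m−1}` of THEOREM-A (1.3) are the `A`-side
`Extᵐ_A(M|_A, N|_A)`, `ker (u₂ − u₁)`, `coker (u₂ − u₁)`. [folklore] -/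
theorem exists_extBaseChange_relative (b : Module.Basis ℕ A R) (N : ModuleCat.{u} R) (n : ℕ) :
    ∃ Ψ : Ext.{u} (ModuleCat.of A M)
          ((ModuleCat.restrictScalars.{u, u, u} (algebraMap A R)).obj N) n →+
        Ext.{u} (ModuleCat.of R (R ⊗[A] M)) N n,
      Function.Bijective Ψ ∧
      (∀ (c : A) (e : Ext.{u} (ModuleCat.of A M)
          ((ModuleCat.restrictScalars.{u, u, u} (algebraMap A R)).obj N) n),
        Ψ (c • e) = algebraMap A R c • Ψ e) ∧
      (∀ e : Ext.{u} (ModuleCat.of A M)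
          ((ModuleCat.restrictScalars.{u, u, u} (algebraMap A R)).obj N) n,
        (Ext.mk₀ (ModuleCat.ofHom (X := R ⊗[A] M) (Y := R ⊗[A] M) T)).comp (Ψ e) (zero_add n) =
          Ψ (e.comp (Ext.mk₀ ((ModuleCat.restrictScalars.{u, u, u} (algebraMap A R)).map
                (x • 𝟙 N))) (add_zero n) -
            (Ext.mk₀ (ModuleCat.ofHom ((LinearMap.lsmul R M x).restrictScalars A))).comp e
              (zero_add n))) ∧
      (∀ e : Ext.{u} (ModuleCat.of A M)
          ((ModuleCat.restrictScalars.{u, u, u} (algebraMap A R)).obj N) n,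
        (Ext.mk₀ (ModuleCat.ofHom (X := R ⊗[A] M) (Y := R ⊗[A] M) T)).comp (Ψ e) (zero_add n) = 0 ↔
          e.comp (Ext.mk₀ ((ModuleCat.restrictScalars.{u, u, u} (algebraMap A R)).map
                (x • 𝟙 N))) (add_zero n) =
            (Ext.mk₀ (ModuleCat.ofHom ((LinearMap.lsmul R M x).restrictScalars A))).comp e
              (zero_add n)) := by
  have hf : (algebraMap A R).Flat := by
    haveI : Module.Free A R := Module.Free.of_basis b
    exact RingHom.flat_algebraMap_iff.mpr inferInstance
  obtain ⟨Φ, hbij, hsmul, hnatX, hnatN⟩ := exists_extBaseChange (algebraMap A R) hf N n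
  obtain ⟨ι, hι⟩ := exists_iso_extendScalars_comm x T hT
  let Ψ : Ext.{u} (ModuleCat.of A M) ((ModuleCat.restrictScalars.{u, u, u} (algebraMap A R)).obj N) n →+
      Ext.{u} (ModuleCat.of R (R ⊗[A] M)) N n :=
    AddMonoidHom.mk' (fun e => (Ext.mk₀ ι.hom).comp (Φ (ModuleCat.of A M) e) (zero_add n))
      (fun e₁ e₂ => by rw [map_add, Ext.comp_add])
  have hΨ : ∀ e, Ψ e = (Ext.mk₀ ι.hom).comp (Φ (ModuleCat.of A M) e) (zero_add n) := fun _ => rfl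
  have hinv : ∀ y : Ext.{u} ((ModuleCat.extendScalars.{u, u, u} (algebraMap A R)).obj
      (ModuleCat.of A M)) N n,
      (Ext.mk₀ ι.inv).comp ((Ext.mk₀ ι.hom).comp y (zero_add n)) (zero_add n) = y := by
    intro y
    rw [Ext.mk₀_comp_mk₀_assoc, ι.inv_hom_id, Ext.mk₀_id_comp]
  have hinv' : ∀ y' : Ext.{u} (ModuleCat.of R (R ⊗[A] M)) N n,
      (Ext.mk₀ ι.hom).comp ((Ext.mk₀ ι.inv).comp y' (zero_add n)) (zero_add n) = y' := by
    intro y'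
    rw [Ext.mk₀_comp_mk₀_assoc, ι.hom_inv_id, Ext.mk₀_id_comp]
  have hinj : Function.Injective Ψ := by
    intro e₁ e₂ h
    rw [hΨ, hΨ] at h
    have h' := congrArg (fun y => (Ext.mk₀ ι.inv).comp y (zero_add n)) h
    simp only [hinv] at h'
    exact (hbij _).1 h'
  suffices hT' : ∀ e, (Ext.mk₀ (ModuleCat.ofHom (X := R ⊗[A] M) (Y := R ⊗[A] M) T)).comp (Ψ e)
      (zero_add n) = Ψ (e.comp (Ext.mk₀ ((ModuleCat.restrictScalars.{u, u, u} (algebraMap A R)).map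
        (x • 𝟙 N))) (add_zero n) -
          (Ext.mk₀ (ModuleCat.ofHom ((LinearMap.lsmul R M x).restrictScalars A))).comp e
            (zero_add n)) by
    refine ⟨Ψ, ⟨hinj, fun y' => ?_⟩, fun c e => ?_, hT', fun e => ?_⟩
    · -- surjective
      obtain ⟨e, he⟩ := (hbij (ModuleCat.of A M)).2 ((Ext.mk₀ ι.inv).comp y' (zero_add n))
      exact ⟨e, by rw [hΨ, he, hinv']⟩
    · -- scalars
      rw [hΨ, hΨ, hsmul, Ext.comp_smul]
    · -- `K_m ↔ ker (u₂ − u₁)`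
      rw [hT', ← map_zero Ψ, hinj.eq_iff, sub_eq_zero]
  -- `T^* = u₂ − u₁`
  intro e
  have hmk₀sub : ∀ {P Q : ModuleCat.{u} R} (f g : P ⟶ Q),
      Ext.mk₀ (f - g) = Ext.mk₀ f - Ext.mk₀ g := by
    intro P Q f g
    rw [sub_eq_add_neg, Ext.mk₀_add, Ext.mk₀_neg, ← sub_eq_add_neg]
  have hsub_comp : ∀ {P Q W : ModuleCat.{u} R} (α₁ α₂ : Ext.{u} P Q 0) (β : Ext.{u} Q W n),
      (α₁ - α₂).comp β (zero_add n) = α₁.comp β (zero_add n) - α₂.comp β (zero_add n) := by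
    intro P Q W α₁ α₂ β
    rw [sub_eq_add_neg, Ext.add_comp, Ext.neg_comp, ← sub_eq_add_neg]
  have hcomp_sub : ∀ {P Q W : ModuleCat.{u} R} (α : Ext.{u} P Q 0) (β₁ β₂ : Ext.{u} Q W n),
      α.comp (β₁ - β₂) (zero_add n) = α.comp β₁ (zero_add n) - α.comp β₂ (zero_add n) := by
    intro P Q W α β₁ β₂
    rw [sub_eq_add_neg, Ext.comp_add, Ext.comp_neg, ← sub_eq_add_neg]
  have hP1 : (Ext.mk₀ (x • 𝟙 _)).comp (Φ (ModuleCat.of A M) e) (zero_add n) =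
      Φ (ModuleCat.of A M) (e.comp (Ext.mk₀
        ((ModuleCat.restrictScalars.{u, u, u} (algebraMap A R)).map (x • 𝟙 N))) (add_zero n)) := by
    rw [← smul_eq_mk₀_smul_id_comp, Ext.smul_eq_comp_mk₀, ← hnatN]
  have hP2 : (Ext.mk₀ ((ModuleCat.extendScalars.{u, u, u} (algebraMap A R)).map
        (ModuleCat.ofHom ((LinearMap.lsmul R M x).restrictScalars A)))).comp
          (Φ (ModuleCat.of A M) e) (zero_add n) =
      Φ (ModuleCat.of A M) ((Ext.mk₀
        (ModuleCat.ofHom ((LinearMap.lsmul R M x).restrictScalars A))).comp e (zero_add n)) := by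
    rw [hnatX]
  rw [map_sub, hΨ, hΨ, hΨ, Ext.mk₀_comp_mk₀_assoc, hι, ← Ext.mk₀_comp_mk₀_assoc, hmk₀sub,
    hsub_comp, hP1, hP2, hcomp_sub]

end Transport

/-! ## §3 The secondary action of an annihilator of `E_m` on `Ext^{m+1}_R(M, N)` (skeleton of THEOREM-A (i)/(ii)) -/

section Secondary

variable {T μ} {w : ModuleCat.ofHom (X := R ⊗[A] M) (Y := R ⊗[A] M) T ≫
    ModuleCat.ofHom (X := R ⊗[A] M) (Y := M) μ = 0}
  (hS : (ShortComplex.mk (ModuleCat.ofHom (X := R ⊗[A] M) (Y := R ⊗[A] M) T)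
    (ModuleCat.ofHom (X := R ⊗[A] M) (Y := M) μ) w).ShortExact)
  {N : ModuleCat.{u} R} {m : ℕ} {c : R}
include hS

/-- **`c • e ∈ im ∂ = C_m`** (THEOREM-A (i), first half: «`c · e = ι(…)`»): if `c` kills
`E_{m+1} = Ext^{m+1}(R ⊗_A M, N)` then for every `e ∈ Ext^{m+1}_R(M, N)`, `c • e = ∂ y` for some
`y ∈ E_m` (because `μ^*(c • e) = c • μ^* e = 0`). [folklore] -/
theorem exists_extClass_comp_eq_smul
    (hc₁ : ∀ e' : Ext.{u} (ModuleCat.of R (R ⊗[A] M)) N (m + 1), c • e' = 0)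
    (e : Ext.{u} (ModuleCat.of R M) N (m + 1)) :
    ∃ y : Ext.{u} (ModuleCat.of R (R ⊗[A] M)) N m, hS.extClass.comp y (add_comm 1 m) = c • e := by
  refine (mk₀μ_comp_eq_zero_iff hS (c • e)).mp ?_
  rw [Ext.comp_smul, hc₁]

/-- **`c` kills `im ∂`** (THEOREM-A (i), the other half of «exponent two»): if `c` kills
`E_m = Extᵐ(R ⊗_A M, N)` then `c • ∂ y = ∂ (c • y) = 0`. [folklore] -/
theorem smul_extClass_comp_eq_zero
    (hc₀ : ∀ y : Ext.{u} (ModuleCat.of R (R ⊗[A] M)) N m, c • y = 0)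
    (y : Ext.{u} (ModuleCat.of R (R ⊗[A] M)) N m) :
    c • hS.extClass.comp y (add_comm 1 m) = 0 := by
  rw [← Ext.comp_smul, hc₀, Ext.comp_zero]

/-- **The secondary action is defined on `K_{m+1}`** (skeleton of THEOREM-A (i)): if `c` kills
`E_m = Extᵐ(R ⊗_A M, N)`, then `c • e` (`e ∈ Ext^{m+1}_R(M, N)`) depends only on `ρ e = μ^* e ∈ K_{m+1}`
— two classes with the same image under `μ^*` differ by `∂ y`, which `c` kills. (THEOREM-A (i) computes this well-defined map
`K_{m+1} → C_m` as `−ω^*` modulo `(u₂ − u₁)E_m`; the formula needs the cone resolution and is not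
formalised here.) [folklore] -/
theorem smul_eq_smul_of_mk₀μ_comp_eq
    (hc₀ : ∀ y : Ext.{u} (ModuleCat.of R (R ⊗[A] M)) N m, c • y = 0)
    {e₁ e₂ : Ext.{u} (ModuleCat.of R M) N (m + 1)}
    (h : (Ext.mk₀ (ModuleCat.ofHom (X := R ⊗[A] M) (Y := M) μ)).comp e₁ (zero_add (m + 1)) =
      (Ext.mk₀ (ModuleCat.ofHom (X := R ⊗[A] M) (Y := M) μ)).comp e₂ (zero_add (m + 1))) :
    c • e₁ = c • e₂ := by
  have h0 : (Ext.mk₀ (ModuleCat.ofHom (X := R ⊗[A] M) (Y := M) μ)).comp (e₁ - e₂)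
      (zero_add (m + 1)) = 0 := by
    rw [sub_eq_add_neg, Ext.comp_add, Ext.comp_neg, h, add_neg_cancel]
  obtain ⟨y, hy⟩ := (mk₀μ_comp_eq_zero_iff hS (e₁ - e₂)).mp h0
  have := smul_extClass_comp_eq_zero hS hc₀ y
  rw [hy, smul_sub, sub_eq_zero] at this
  exact this

/-- **Exponent-one criterion, skeleton of THEOREM-A (ii)**: if `c` kills `E_m = Extᵐ(R ⊗_A M, N)`,
then `c` kills `Ext^{m+1}_R(M, N)` iff `c` kills ONE chosen lift `s e'` of every `e' ∈ K_{m+1} = ker T^*`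
(any family of lifts `μ^* (s e') = e'`; lifts exist by `mk₀T_comp_eq_zero_iff`). THEOREM-A (ii)
makes the right-hand side explicit (`ω^*(K_{m+1}) ⊆ (u₂ − u₁) E_m`). [folklore] -/
theorem forall_smul_ext_eq_zero_iff_lifts
    (hc₀ : ∀ y : Ext.{u} (ModuleCat.of R (R ⊗[A] M)) N m, c • y = 0)
    (s : Ext.{u} (ModuleCat.of R (R ⊗[A] M)) N (m + 1) → Ext.{u} (ModuleCat.of R M) N (m + 1))
    (hs : ∀ e' : Ext.{u} (ModuleCat.of R (R ⊗[A] M)) N (m + 1),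
      (Ext.mk₀ (ModuleCat.ofHom (X := R ⊗[A] M) (Y := R ⊗[A] M) T)).comp e' (zero_add (m + 1)) = 0 →
        (Ext.mk₀ (ModuleCat.ofHom (X := R ⊗[A] M) (Y := M) μ)).comp (s e') (zero_add (m + 1)) = e') :
    (∀ e : Ext.{u} (ModuleCat.of R M) N (m + 1), c • e = 0) ↔
      ∀ e' : Ext.{u} (ModuleCat.of R (R ⊗[A] M)) N (m + 1),
        (Ext.mk₀ (ModuleCat.ofHom (X := R ⊗[A] M) (Y := R ⊗[A] M) T)).comp e' (zero_add (m + 1)) = 0 →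
          c • s e' = 0 := by
  refine ⟨fun h e' _ => h (s e'), fun h e => ?_⟩
  -- `ρ e ∈ K_{m+1}`, so `c • e = c • s (ρ e) = 0`
  have hK : (Ext.mk₀ (ModuleCat.ofHom (X := R ⊗[A] M) (Y := R ⊗[A] M) T)).comp
      ((Ext.mk₀ (ModuleCat.ofHom (X := R ⊗[A] M) (Y := M) μ)).comp e (zero_add (m + 1)))
        (zero_add (m + 1)) = 0 :=
    (mk₀T_comp_eq_zero_iff hS _).mpr ⟨e, rfl⟩
  rw [smul_eq_smul_of_mk₀μ_comp_eq hS hc₀ (hs _ hK).symm]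
  exact h _ hK

end Secondary


end Summit.ResolutionOfSingularities.ResolutionOfSingularities.Theorems.HomologicalConductor.PersistenceRelativeExtSequence
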